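/-
HONEST FRAMING: systematic search; no irrationality claim unless certified.
-/
import Summits.KontsevichZagierPeriods.Zeta5Search.WedgeDictionaryRowsA
import Summits.KontsevichZagierPeriods.Zeta5Search.WedgeDictionaryTemplateK6
import Summits.KontsevichZagierPeriods.Zeta5Search.WedgeDictionaryLayerK6X2
import Summits.KontsevichZagierPeriods.Zeta5Search.WedgeDictionaryLayerK6X1
import Summits.KontsevichZagierPeriods.Zeta5Search.WedgeDictionaryTopSixMax
import Summits.KontsevichZagierPeriods.Zeta5Search.WedgeDictionaryBase4_0222222
import Summits.KontsevichZagierPeriods.Zeta5Search.WedgeDictionaryBase2_0111111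
import Summits.KontsevichZagierPeriods.Zeta5Search.WedgeDictionaryLayerAxis
import Summits.KontsevichZagierPeriods.Zeta5Search.WedgeDictionaryBase3_0000000
import Summits.KontsevichZagierPeriods.Zeta5Search.WedgeDictionaryBase2_0000000
import Summits.KontsevichZagierPeriods.Zeta5Search.WedgeDictionaryTopPair17
import Summits.KontsevichZagierPeriods.Zeta5Search.WedgeDictionaryTopPair27
import Summits.KontsevichZagierPeriods.Zeta5Search.WedgeDictionaryTopPair35
import Summits.KontsevichZagierPeriods.Zeta5Search.WedgeDictionaryTopPair45
import Summits.KontsevichZagierPeriods.Zeta5Search.WedgeDictionaryTerminalRowsD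
import Summits.KontsevichZagierPeriods.Zeta5Search.WedgeDictionaryGhostFace46
import Summits.KontsevichZagierPeriods.Zeta5Search.Elimination.DictBridgeLevelOne
import HarnessLib

/-!
# Row discharge of the terminal-template programme, part B (rows 6, tops, axis; `explicitPQ` from level-1 values)

HONEST FRAMING: systematic search; no irrationality claim unless certified.
OUR work (Summit side; cell `pub-zeta5`, planner gen-1 g18 = compact renderer v3 of gen-1 g17's `WedgeDictionaryRows`, 2026-08-21;
memo `pub-zeta5-gen-1/D2-TERMINAL-g17.md` §2d; generator `code/gen1/g18/renderR.py`).

This part: rows 6, six-max top, axis, the four ordinary top pairs, the two ghost pairs (the tree's `explicitPQAt_ghostClass`), and the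
assembly `explicitPQ_of_data` (STAR / PENCIL / BRIDGE families + invariance (27) + eight level-1 values ⇒ `explicitPQ`), the reduction
of the eight values to four by the generators `i₁`, `p₀₁`, and `explicitPQ_of_data4'` with the BRIDGE dictionary relation
`DictBridge` discharged BY NAME by the tree's `Elimination.dictBridge_holds`.
Nothing analytic; nothing about irrationality. [folklore]
-/

noncomputable section

open Finset

namespace Summit.KontsevichZagierPeriods.Zeta5Search.WedgeDictionary

open Literature.NumberTheory.Irrationality.BrownZudilin2022 (bOfA genI1 genP01 invariance_of_converges')
open CertKit

namespace Rows

set_option maxHeartbeats 4000000 in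
/-- Row 6 `(N; x⁶, 0)`, `N ≥ 2x+1`: generic template for `x ≥ 3`, layers `x = 1, 2`. [folklore] -/
theorem row6 (hcS : CellStar) (hdS : DictStar) (hcP : CellPencil) (hdP : DictPencil) (hcB : CellBridge) (hdB : DictBridge) : Row6 := by
  intro x N hx hN IH a' h0 h1 h2 h3 h4 h5 h6 h7
  have IH' : ∀ (c : Fin 8 → ℤ) (j' : ℕ), bOfA c 0 < bOfA a' 0 → RegionHyp c j' → ExplicitPQAt c j' :=
    fun c j' hc hrc => IH c j' (by omega) hrc
  by_cases hx3 : 3 ≤ x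
  · exact TemplateK6.explicitPQAt_of_lower hcS hdS hcP hdP hcB hdB (x := x) (N := N) hx3
      (by omega) (by omega) (by omega) (by omega) (by omega) (by omega) (by omega) (by omega) (by omega) IH'
  · by_cases hx2 : x = 2
    · subst hx2; exact LayerK6X2.explicitPQAt_of_lower hcS hdS hcP hdP hcB hdB (N := N)
        (by omega) (by omega) (by omega) (by omega) (by omega) (by omega) (by omega) (by omega) (by omega) IH'
    · have hx1 : x = 1 := by omega
      subst hx1; exact LayerK6X1.explicitPQAt_of_lower hcP hdP hcB hdB (N := N)
          (by omega) (by omega) (by omega) (by omega) (by omega) (by omega) (by omega) (by omega) (by omega) IH'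

set_option maxHeartbeats 4000000 in
/-- Six-max top row `(2x; 0, x⁶)`: top family for `x ≥ 3`, base points `x = 1, 2`. [folklore] -/
theorem row6Top (hcS : CellStar) (hdS : DictStar) (hcP : CellPencil) (hdP : DictPencil) (hcB : CellBridge) (hdB : DictBridge) : Row6Top := by
  intro x hx IH a' h0 h1 h2 h3 h4 h5 h6 h7
  have IH' : ∀ (c : Fin 8 → ℤ) (j' : ℕ), bOfA c 0 < bOfA a' 0 → RegionHyp c j' → ExplicitPQAt c j' :=
    fun c j' hc hrc => IH c j' (by omega) hrc
  by_cases hx3 : 3 ≤ x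
  · exact TopSixMax.explicitPQAt_of_lower hcS hdS hcP hdP hcB hdB (V := x) hx3
      (by omega) (by omega) (by omega) (by omega) (by omega) (by omega) (by omega) (by omega) IH'
  · by_cases hx2 : x = 2
    · subst hx2; exact Base4_0222222.explicitPQAt_of_lower hcS hdS hcP hdP hcB hdB
        (by omega) (by omega) (by omega) (by omega) (by omega) (by omega) (by omega) (by omega) IH'
    · have hx1 : x = 1 := by omega
      subst hx1; exact Base2_0111111.explicitPQAt_of_lower hcS hdS hcP hdP hcB hdB
          (by omega) (by omega) (by omega) (by omega) (by omega) (by omega) (by omega) (by omega) IH'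

set_option maxHeartbeats 4000000 in
/-- Axis row `(N; 0⁷)`, `N ≥ 1`, any partner: layer for `N ≥ 4`, base points `N = 2, 3`, the level-1 value `D1`. [folklore] -/
theorem rowAxis (hcS : CellStar) (hdS : DictStar) (hcP : CellPencil) (hdP : DictPencil) (hcB : CellBridge) (hdB : DictBridge)
    (D1 : ExplicitPQAt ![1,0,1,0,1,1,1,1] 1) : RowAxis := by
  intro N hN1 IH a' j h0 h1 h2 h3 h4 h5 h6 h7 hr
  have IH' : ∀ (c : Fin 8 → ℤ) (j' : ℕ), bOfA c 0 < bOfA a' 0 → RegionHyp c j' → ExplicitPQAt c j' :=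
    fun c j' hc hrc => IH c j' (by omega) hrc
  refine explicitPQAt_partner (regionHyp_zero_slot hr (by decide) h1) hr ?_
  by_cases hN4 : 4 ≤ N
  · exact LayerAxis.explicitPQAt_of_lower hcS hdS hcP hdP hcB hdB (N := N) hN4
      (by omega) (by omega) (by omega) (by omega) (by omega) (by omega) (by omega) (by omega) IH'
  · by_cases hN3 : N = 3
    · subst hN3; exact Base3_0000000.explicitPQAt_of_lower hcS hdS hcP hdP hcB hdB
        (by omega) (by omega) (by omega) (by omega) (by omega) (by omega) (by omega) (by omega) IH'
    · by_cases hN2 : N = 2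
      · subst hN2; exact Base2_0000000.explicitPQAt_of_lower hcS hdS hcP hdP hcB hdB
          (by omega) (by omega) (by omega) (by omega) (by omega) (by omega) (by omega) (by omega) IH'
      · have hN1' : N = 1 := by omega
        subst hN1'
        rw [eq_of_bOfA ![1,0,1,0,1,1,1,1] (by decide) h0 h1 h2 h3 h4 h5 h6 h7]
        exact D1

set_option maxHeartbeats 4000000 in
/-- Top pair `{1,7}` at level `2x−1`: top family for `x ≥ 2`, the level-1 value `D17`. [folklore] -/
theorem rowTop17 (hcS : CellStar) (hdS : DictStar) (hcP : CellPencil) (hdP : DictPencil)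
    (D17 : ExplicitPQAt ![0,0,1,0,1,1,0,1] 2) : RowTop17 := by
  intro x hx IH a' j h0 h1 h2 h3 h4 h5 h6 h7 hr
  have IH' : ∀ (c : Fin 8 → ℤ) (j' : ℕ), bOfA c 0 < bOfA a' 0 → RegionHyp c j' → ExplicitPQAt c j' :=
    fun c j' hc hrc => IH c j' (by omega) hrc
  refine explicitPQAt_partner (regionHyp_zero_slot hr (by decide) h2) hr ?_
  by_cases hx2 : 2 ≤ x
  · exact TopPair17.explicitPQAt_of_lower hcS hdS hcP hdP (V := x - 1)
      (by omega) (by omega) (by omega) (by omega) (by omega) (by omega) (by omega) (by omega) (by omega) IH'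
  · have hx1 : x = 1 := by omega
    subst hx1
    rw [eq_of_bOfA ![0,0,1,0,1,1,0,1] (by decide) h0 h1 h2 h3 h4 h5 h6 h7]
    exact D17

set_option maxHeartbeats 4000000 in
/-- Top pair `{2,7}` at level `2x−1`: top family for `x ≥ 2`, the level-1 value `D27`. [folklore] -/
theorem rowTop27 (hcS : CellStar) (hdS : DictStar) (hcP : CellPencil) (hdP : DictPencil)
    (D27 : ExplicitPQAt ![0,1,0,0,1,1,0,1] 1) : RowTop27 := by
  intro x hx IH a' j h0 h1 h2 h3 h4 h5 h6 h7 hr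
  have IH' : ∀ (c : Fin 8 → ℤ) (j' : ℕ), bOfA c 0 < bOfA a' 0 → RegionHyp c j' → ExplicitPQAt c j' :=
    fun c j' hc hrc => IH c j' (by omega) hrc
  refine explicitPQAt_partner (regionHyp_zero_slot hr (by decide) h1) hr ?_
  by_cases hx2 : 2 ≤ x
  · exact TopPair27.explicitPQAt_of_lower hcS hdS hcP hdP (V := x - 1)
      (by omega) (by omega) (by omega) (by omega) (by omega) (by omega) (by omega) (by omega) (by omega) IH'
  · have hx1 : x = 1 := by omega
    subst hx1
    rw [eq_of_bOfA ![0,1,0,0,1,1,0,1] (by decide) h0 h1 h2 h3 h4 h5 h6 h7]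
    exact D27

set_option maxHeartbeats 4000000 in
/-- Top pair `{3,5}` at level `2x−1`: top family for `x ≥ 2`, the level-1 value `D35`. [folklore] -/
theorem rowTop35 (hcS : CellStar) (hdS : DictStar) (hcP : CellPencil) (hdP : DictPencil)
    (D35 : ExplicitPQAt ![1,0,0,1,0,0,1,-1] 1) : RowTop35 := by
  intro x hx IH a' j h0 h1 h2 h3 h4 h5 h6 h7 hr
  have IH' : ∀ (c : Fin 8 → ℤ) (j' : ℕ), bOfA c 0 < bOfA a' 0 → RegionHyp c j' → ExplicitPQAt c j' :=
    fun c j' hc hrc => IH c j' (by omega) hrc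
  refine explicitPQAt_partner (regionHyp_zero_slot hr (by decide) h1) hr ?_
  by_cases hx2 : 2 ≤ x
  · exact TopPair35.explicitPQAt_of_lower hcS hdS hcP hdP (V := x - 1)
      (by omega) (by omega) (by omega) (by omega) (by omega) (by omega) (by omega) (by omega) (by omega) IH'
  · have hx1 : x = 1 := by omega
    subst hx1
    rw [eq_of_bOfA ![1,0,0,1,0,0,1,-1] (by decide) h0 h1 h2 h3 h4 h5 h6 h7]
    exact D35

set_option maxHeartbeats 4000000 in
/-- Top pair `{4,5}` at level `2x−1`: top family for `x ≥ 2`, the level-1 value `D45`. [folklore] -/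
theorem rowTop45 (hcS : CellStar) (hdS : DictStar) (hcP : CellPencil) (hdP : DictPencil)
    (D45 : ExplicitPQAt ![1,0,1,0,0,0,1,0] 1) : RowTop45 := by
  intro x hx IH a' j h0 h1 h2 h3 h4 h5 h6 h7 hr
  have IH' : ∀ (c : Fin 8 → ℤ) (j' : ℕ), bOfA c 0 < bOfA a' 0 → RegionHyp c j' → ExplicitPQAt c j' :=
    fun c j' hc hrc => IH c j' (by omega) hrc
  refine explicitPQAt_partner (regionHyp_zero_slot hr (by decide) h1) hr ?_
  by_cases hx2 : 2 ≤ x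
  · exact TopPair45.explicitPQAt_of_lower hcS hdS hcP hdP (V := x - 1)
      (by omega) (by omega) (by omega) (by omega) (by omega) (by omega) (by omega) (by omega) (by omega) IH'
  · have hx1 : x = 1 := by omega
    subst hx1
    rw [eq_of_bOfA ![1,0,1,0,0,0,1,0] (by decide) h0 h1 h2 h3 h4 h5 h6 h7]
    exact D45

/-- Ghost pair `{1,6}` at level `2x−1`: the tree's two-top face theorem `explicitPQAt_ghostClass`. [folklore] -/
theorem rowTop16 (hcS : CellStar) (hdS : DictStar) (hcP : CellPencil) (hdP : DictPencil)
    (D16 : ExplicitPQAt ![0,0,1,0,1,0,0,1] 2) (D46 : ExplicitPQAt ![1,0,1,0,0,0,0,1] 2) : RowTop16 := by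
  intro x _ _ a' j h0 h1 h2 _ _ _ h6 _ hr
  have hr2 : RegionHyp a' 2 := regionHyp_zero_slot hr (by decide) h2
  exact explicitPQAt_partner hr2 hr (explicitPQAt_ghostClass hcS hdS hcP hdP D16 D46 a' hr2 (Or.inl ⟨by omega, by omega⟩))

/-- Ghost pair `{4,6}` at level `2x−1`: the tree's two-top face theorem `explicitPQAt_ghostClass`. [folklore] -/
theorem rowTop46 (hcS : CellStar) (hdS : DictStar) (hcP : CellPencil) (hdP : DictPencil)
    (D16 : ExplicitPQAt ![0,0,1,0,1,0,0,1] 2) (D46 : ExplicitPQAt ![1,0,1,0,0,0,0,1] 2) : RowTop46 := by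
  intro x _ _ a' j h0 _ h2 _ h4 _ h6 _ hr
  have hr2 : RegionHyp a' 2 := regionHyp_zero_slot hr (by decide) h2
  exact explicitPQAt_partner hr2 hr (explicitPQAt_ghostClass hcS hdS hcP hdP D16 D46 a' hr2 (Or.inr ⟨by omega, by omega⟩))

/-- **`explicitPQ` from eight level-1 values** (modulo the STAR / PENCIL / BRIDGE contiguity families and the cited invariance (27)):
the terminal-template programme assembled. [folklore] -/
theorem explicitPQ_of_data (hcS : CellStar) (hdS : DictStar) (hcP : CellPencil) (hdP : DictPencil) (hcB : CellBridge) (hdB : DictBridge) (hInv : invariance_of_converges')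
    (D1 : ExplicitPQAt ![1,0,1,0,1,1,1,1] 1) (D2 : ExplicitPQAt ![0,0,1,0,1,1,1,1] 2)
    (D16 : ExplicitPQAt ![0,0,1,0,1,0,0,1] 2) (D46 : ExplicitPQAt ![1,0,1,0,0,0,0,1] 2)
    (D17 : ExplicitPQAt ![0,0,1,0,1,1,0,1] 2) (D27 : ExplicitPQAt ![0,1,0,0,1,1,0,1] 1)
    (D35 : ExplicitPQAt ![1,0,0,1,0,0,1,-1] 1) (D45 : ExplicitPQAt ![1,0,1,0,0,0,1,0] 1) : explicitPQ :=
  explicitPQ_of_rows hcS hdS hcP hdP hInv (rowAxis hcS hdS hcP hdP hcB hdB D1) (row1 hcS hdS hcP hdP hcB hdB D2) (row2 hcS hdS hcP hdP hcB hdB)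
    (row3 hcS hdS hcP hdP hcB hdB) (row4 hcS hdS hcP hdP hcB hdB) (row5 hcS hdS hcP hdP hcB hdB) (row6 hcS hdS hcP hdP hcB hdB)
    (row6Top hcS hdS hcP hdP hcB hdB) (rowTop16 hcS hdS hcP hdP D16 D46) (rowTop17 hcS hdS hcP hdP D17) (rowTop27 hcS hdS hcP hdP D27)
    (rowTop35 hcS hdS hcP hdP D35) (rowTop45 hcS hdS hcP hdP D45) (rowTop46 hcS hdS hcP hdP D16 D46)

/-! ## Reduction of the level-1 data by the generators `i₁`, `p₀₁` (eight values → four)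
The involution `i₁` permutes the dual slots by `(14)(23)(57)` and `p₀₁` by `(34)`; at level 1 they identify the top-pair points
`{4,5} ↔ {1,7}`, `{3,5} ↔ {4,5}`, `{2,7} ↔ {3,5}`, `{4,6} ↔ {1,6}` (the images are `decide`d), so four of the eight values follow from
the others by the pull-backs of `WedgeDictionaryAssemblyGlue` (modulo the cited invariance (27)). [folklore] -/

/-- `D45_of_D17`: the value at `![1,0,1,0,0,0,1,0]` (partner 1) from the value at its `genI1`-image `![0,0,1,0,1,1,0,1]` (partner 2). [folklore] -/
theorem D45_of_D17 (hInv : invariance_of_converges') (D17 : ExplicitPQAt ![0,0,1,0,1,1,0,1] 2) : ExplicitPQAt ![1,0,1,0,0,0,1,0] 1 := by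
  have e : genI1 ![1,0,1,0,0,0,1,0] = ![0,0,1,0,1,1,0,1] := by decide
  exact explicitPQAt_pull_genI1 hInv (j := 2) (by decide) (by rw [e]; decide) (by rw [e]; exact D17)

/-- `D35_of_D45`: the value at `![1,0,0,1,0,0,1,-1]` (partner 1) from the value at its `genP01`-image `![1,0,1,0,0,0,1,0]` (partner 1). [folklore] -/
theorem D35_of_D45 (hInv : invariance_of_converges') (D45 : ExplicitPQAt ![1,0,1,0,0,0,1,0] 1) : ExplicitPQAt ![1,0,0,1,0,0,1,-1] 1 := by
  have e : genP01 ![1,0,0,1,0,0,1,-1] = ![1,0,1,0,0,0,1,0] := by decide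
  exact explicitPQAt_pull_genP01 hInv (j := 1) (by decide) (by rw [e]; decide) (by rw [e]; exact D45)

/-- `D27_of_D35`: the value at `![0,1,0,0,1,1,0,1]` (partner 1) from the value at its `genI1`-image `![1,0,0,1,0,0,1,-1]` (partner 1). [folklore] -/
theorem D27_of_D35 (hInv : invariance_of_converges') (D35 : ExplicitPQAt ![1,0,0,1,0,0,1,-1] 1) : ExplicitPQAt ![0,1,0,0,1,1,0,1] 1 := by
  have e : genI1 ![0,1,0,0,1,1,0,1] = ![1,0,0,1,0,0,1,-1] := by decide
  exact explicitPQAt_pull_genI1 hInv (j := 1) (by decide) (by rw [e]; decide) (by rw [e]; exact D35)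

/-- `D46_of_D16`: the value at `![1,0,1,0,0,0,0,1]` (partner 2) from the value at its `genI1`-image `![0,0,1,0,1,0,0,1]` (partner 2). [folklore] -/
theorem D46_of_D16 (hInv : invariance_of_converges') (D16 : ExplicitPQAt ![0,0,1,0,1,0,0,1] 2) : ExplicitPQAt ![1,0,1,0,0,0,0,1] 2 := by
  have e : genI1 ![1,0,1,0,0,0,0,1] = ![0,0,1,0,1,0,0,1] := by decide
  exact explicitPQAt_pull_genI1 hInv (j := 2) (by decide) (by rw [e]; decide) (by rw [e]; exact D16)

/-- **`explicitPQ` from FOUR level-1 values** — the axis point `(1;0⁷)`, `(1;1,0⁶)`, the ghost pair `(1;1,0,0,0,0,1,0)` and the top pair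
`(1;1,0⁵,1)` — modulo the STAR / PENCIL / BRIDGE contiguity families and the cited invariance (27). [folklore] -/
theorem explicitPQ_of_data4 (hcS : CellStar) (hdS : DictStar) (hcP : CellPencil) (hdP : DictPencil) (hcB : CellBridge) (hdB : DictBridge) (hInv : invariance_of_converges')
    (D1 : ExplicitPQAt ![1,0,1,0,1,1,1,1] 1) (D2 : ExplicitPQAt ![0,0,1,0,1,1,1,1] 2)
    (D16 : ExplicitPQAt ![0,0,1,0,1,0,0,1] 2) (D17 : ExplicitPQAt ![0,0,1,0,1,1,0,1] 2) : explicitPQ :=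
  explicitPQ_of_data hcS hdS hcP hdP hcB hdB hInv D1 D2 D16 (D46_of_D16 hInv D16) D17
    (D27_of_D35 hInv (D35_of_D45 hInv (D45_of_D17 hInv D17))) (D35_of_D45 hInv (D45_of_D17 hInv D17)) (D45_of_D17 hInv D17)

/-- **`explicitPQ` from four level-1 values, the BRIDGE dictionary relation discharged** by the tree's
`Elimination.dictBridge_holds` (`Elimination/DictBridgeLevelOne`): what remains hypothetical is the STAR / PENCIL families, the
cellular BRIDGE relations `CellBridge`, the cited invariance (27) and the four values. [folklore] -/
theorem explicitPQ_of_data4' (hcS : CellStar) (hdS : DictStar) (hcP : CellPencil) (hdP : DictPencil) (hcB : CellBridge)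
    (hInv : invariance_of_converges')
    (D1 : ExplicitPQAt ![1,0,1,0,1,1,1,1] 1) (D2 : ExplicitPQAt ![0,0,1,0,1,1,1,1] 2)
    (D16 : ExplicitPQAt ![0,0,1,0,1,0,0,1] 2) (D17 : ExplicitPQAt ![0,0,1,0,1,1,0,1] 2) : explicitPQ :=
  explicitPQ_of_data4 hcS hdS hcP hdP hcB Elimination.dictBridge_holds hInv D1 D2 D16 D17

end Rows

end Summit.KontsevichZagierPeriods.Zeta5Search.WedgeDictionary

end
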